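import Mathlib
import Summits.ValiantsHypothesis.ValiantsHypothesis.Theorems.LacunarySymmetroidMatrixDescartesInertiaFirstOrder

/-!
# `MatrixDescartes` (stmt-ValiantsHypothesis-18050) — INERTIA KIT, III-b: THE SIGNATURE LAW FOR INERTIA JUMPS — at a singular
# point `x₀` of a real symmetric family the negative index jumps to the right by EXACTLY the negative part of the kernel form
# `v ↦ vᵀG(x₀)v` on `ker F(x₀)` and to the left by its positive part, whenever that form is non-degenerate

HONEST FRAMING.  Cell `pub-symmetroid`, seat `val-sym-mdr-p2` (gen 17); helper file `--supports` the crux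
`Theses.LacunarySymmetroid.MatrixDescartes`, NO closure claim.  A general tool valid for EVERY real symmetric lacunary pencil at
EVERY format (pencil form in `…InertiaJumpPencil`); it refines the g16 inertia kit (`…InertiaKit`: `ν` is lower semicontinuous
and jumps by at most the corank; `…InertiaParity`: the jump at a SIMPLE root is `±1`) to an EXACT jump at every singular point
whose kernel form is non-degenerate.  Nothing here bears on the crux in its window, on `stub_twoSided`, on `DoorA26`/`DoorA34`,
registers, or `VP ≠ VNP`.

CONTENT (`ν(A) = card {j // hA.eigenvalues j < 0}`, `π(A) = card {j // 0 < hA.eigenvalues j}`, corank `card ι − rank A`; families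
`F x = F x₀ + (x − x₀) • G x` with `G` entrywise continuous and every `F x` hermitian).
* §2 ONE-SIDED JUMPS (`eventually_negIndex_ge_add_right/left`, `eventually_posIndex_ge_add_right/left`): a family of `k` kernel
  vectors of `F x₀` on whose combinations `G x₀` is negative forces `ν(F x) ≥ ν(F x₀) + k` just right of `x₀` and
  `π(F x) ≥ π(F x₀) + k` just left of it; a `G x₀`-positive kernel family does the mirror.  No non-degeneracy needed
  (first-order persistence `…InertiaFirstOrder` + Sylvester in family language `Inertia.card_le_negIndex`).
* §3 THE SIGNATURE LAW (`eventually_indices_eq_right/left`, `negIndex_jump_eq`): kernel families `n⁻` (`G x₀`-negative, size `p`)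
  and `n⁺` (`G x₀`-positive, size `q`) with `p + q = corank F x₀` give, just right of `x₀`: `ν = ν(F x₀) + p`, `π = π(F x₀) + q`,
  `F x` non-singular; just left: `ν = ν(F x₀) + q`, `π = π(F x₀) + p`; hence THE JUMP `ν(x₀⁺) − ν(x₀⁻) = p − q` = minus the
  signature of the kernel form (and `π` jumps by `q − p`).  This is the semisimple case of the «third description of the sign
  characteristic» of hermitian matrix polynomials [GohbergLancasterRodman2005, Thm 12.5.2], obtained here from first-order
  persistence and the count `ν + π + corank = card ι` alone — no analytic eigenvalue branches, no Rellich theorem, no Jordan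
  chains. [folklore]; axioms standard; no definitions.
-/

-- layout Summits/ValiantsHypothesis/ValiantsHypothesis forces the duplicated namespace component
set_option linter.dupNamespace false

namespace Summit.ValiantsHypothesis.ValiantsHypothesis.Theorems.LacunarySymmetroidMatrixDescartes

open Matrix Finset
open scoped BigOperators Topology

namespace Inertia

variable {ι : Type} [Fintype ι] [DecidableEq ι]

/-! ## §2 One-sided jumps of the indices from kernel families -/

omit [Fintype ι] [DecidableEq ι] in
/-- A real hermitian matrix is symmetric. [folklore] -/
theorem isSymm_of_isHermitian {A : Matrix ι ι ℝ} (hA : A.IsHermitian) : A.IsSymm := by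
  have h := hA
  unfold Matrix.IsHermitian at h
  rw [Matrix.conjTranspose_eq_transpose_of_trivial] at h
  exact h

/-- **Right jump of `ν` from a negative kernel family.**  `F x = F x₀ + (x − x₀) • G x` hermitian with `G` entrywise
continuous; `n : β → ℝ^ι` kernel vectors of `F x₀` on whose non-trivial combinations `G x₀` is negative.  Then
`ν(F x) ≥ ν(F x₀) + card β` for all `x > x₀` near `x₀`. [folklore] -/
theorem eventually_negIndex_ge_add_right {β : Type} [Fintype β] (F G : ℝ → Matrix ι ι ℝ) (x₀ : ℝ)
    (hG : ∀ i j, Continuous fun x => G x i j) (hFG : ∀ x, F x = F x₀ + (x - x₀) • G x)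
    (hH : ∀ x, (F x).IsHermitian) (n : β → ι → ℝ) (hn0 : ∀ j, F x₀ *ᵥ n j = 0)
    (hn : ∀ c : β → ℝ, c ≠ 0 → (∑ j, c j • n j) ⬝ᵥ (G x₀ *ᵥ ∑ j, c j • n j) < 0) :
    ∀ᶠ x in 𝓝[>] x₀, Fintype.card {j // (hH x₀).eigenvalues j < 0} + Fintype.card β
      ≤ Fintype.card {j // (hH x).eigenvalues j < 0} := by
  have h := eventually_neg_joint_family_right F G x₀ hG hFG (isSymm_of_isHermitian (hH x₀))
    (fun i : {j // (hH x₀).eigenvalues j < 0} => ((hH x₀).eigenvectorBasis i.1).ofLp) n (neg_eigenFamily (hH x₀)) hn0 hn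
  refine h.mono fun x hx => ?_
  have := card_le_negIndex (hH x) _ hx
  rwa [Fintype.card_sum] at this

/-- **Left jump of `ν` from a positive kernel family.**  With `G x₀` POSITIVE on the kernel family's combinations,
`ν(F x) ≥ ν(F x₀) + card β` for all `x < x₀` near `x₀`. [folklore] -/
theorem eventually_negIndex_ge_add_left {β : Type} [Fintype β] (F G : ℝ → Matrix ι ι ℝ) (x₀ : ℝ)
    (hG : ∀ i j, Continuous fun x => G x i j) (hFG : ∀ x, F x = F x₀ + (x - x₀) • G x)
    (hH : ∀ x, (F x).IsHermitian) (n : β → ι → ℝ) (hn0 : ∀ j, F x₀ *ᵥ n j = 0)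
    (hn : ∀ c : β → ℝ, c ≠ 0 → 0 < (∑ j, c j • n j) ⬝ᵥ (G x₀ *ᵥ ∑ j, c j • n j)) :
    ∀ᶠ x in 𝓝[<] x₀, Fintype.card {j // (hH x₀).eigenvalues j < 0} + Fintype.card β
      ≤ Fintype.card {j // (hH x).eigenvalues j < 0} := by
  have h := eventually_neg_joint_family_left F G x₀ hG hFG (isSymm_of_isHermitian (hH x₀))
    (fun i : {j // (hH x₀).eigenvalues j < 0} => ((hH x₀).eigenvectorBasis i.1).ofLp) n (neg_eigenFamily (hH x₀)) hn0 hn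
  refine h.mono fun x hx => ?_
  have := card_le_negIndex (hH x) _ hx
  rwa [Fintype.card_sum] at this

omit [Fintype ι] [DecidableEq ι] in
/-- Hermitian-ness of the negated family. [folklore] -/
theorem isHermitian_neg_family (F : ℝ → Matrix ι ι ℝ) (hH : ∀ x, (F x).IsHermitian) (x : ℝ) :
    ((fun y => -F y) x).IsHermitian := (hH x).neg

/-- **Right jump of `π` from a positive kernel family**: `π(F x) ≥ π(F x₀) + card β` for `x > x₀` near `x₀`. [folklore] -/
theorem eventually_posIndex_ge_add_right {β : Type} [Fintype β] (F G : ℝ → Matrix ι ι ℝ) (x₀ : ℝ)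
    (hG : ∀ i j, Continuous fun x => G x i j) (hFG : ∀ x, F x = F x₀ + (x - x₀) • G x)
    (hH : ∀ x, (F x).IsHermitian) (n : β → ι → ℝ) (hn0 : ∀ j, F x₀ *ᵥ n j = 0)
    (hn : ∀ c : β → ℝ, c ≠ 0 → 0 < (∑ j, c j • n j) ⬝ᵥ (G x₀ *ᵥ ∑ j, c j • n j)) :
    ∀ᶠ x in 𝓝[>] x₀, Fintype.card {j // 0 < (hH x₀).eigenvalues j} + Fintype.card β
      ≤ Fintype.card {j // 0 < (hH x).eigenvalues j} := by
  have hH' := isHermitian_neg_family F hH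
  have h := eventually_negIndex_ge_add_right (fun y => -F y) (fun y => -G y) x₀ (fun i j => (hG i j).neg)
    (fun x => by
      show -F x = -F x₀ + (x - x₀) • -G x
      rw [hFG x, neg_add, smul_neg]) hH' n
    (fun j => by show -F x₀ *ᵥ n j = 0; rw [Matrix.neg_mulVec, hn0, neg_zero])
    (fun c hc => by
      show (∑ j, c j • n j) ⬝ᵥ (-G x₀ *ᵥ ∑ j, c j • n j) < 0
      rw [Matrix.neg_mulVec, dotProduct_neg, neg_lt_zero]; exact hn c hc)
  refine h.mono fun x hx => ?_
  rw [posIndex_eq_negIndex_neg (hH x₀) (hH' x₀), posIndex_eq_negIndex_neg (hH x) (hH' x)]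
  exact hx

/-- **Left jump of `π` from a negative kernel family**: `π(F x) ≥ π(F x₀) + card β` for `x < x₀` near `x₀`. [folklore] -/
theorem eventually_posIndex_ge_add_left {β : Type} [Fintype β] (F G : ℝ → Matrix ι ι ℝ) (x₀ : ℝ)
    (hG : ∀ i j, Continuous fun x => G x i j) (hFG : ∀ x, F x = F x₀ + (x - x₀) • G x)
    (hH : ∀ x, (F x).IsHermitian) (n : β → ι → ℝ) (hn0 : ∀ j, F x₀ *ᵥ n j = 0)
    (hn : ∀ c : β → ℝ, c ≠ 0 → (∑ j, c j • n j) ⬝ᵥ (G x₀ *ᵥ ∑ j, c j • n j) < 0) :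
    ∀ᶠ x in 𝓝[<] x₀, Fintype.card {j // 0 < (hH x₀).eigenvalues j} + Fintype.card β
      ≤ Fintype.card {j // 0 < (hH x).eigenvalues j} := by
  have hH' := isHermitian_neg_family F hH
  have h := eventually_negIndex_ge_add_left (fun y => -F y) (fun y => -G y) x₀ (fun i j => (hG i j).neg)
    (fun x => by
      show -F x = -F x₀ + (x - x₀) • -G x
      rw [hFG x, neg_add, smul_neg]) hH' n
    (fun j => by show -F x₀ *ᵥ n j = 0; rw [Matrix.neg_mulVec, hn0, neg_zero])
    (fun c hc => by
      show 0 < (∑ j, c j • n j) ⬝ᵥ (-G x₀ *ᵥ ∑ j, c j • n j)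
      rw [Matrix.neg_mulVec, dotProduct_neg, neg_pos]; exact hn c hc)
  refine h.mono fun x hx => ?_
  rw [posIndex_eq_negIndex_neg (hH x₀) (hH' x₀), posIndex_eq_negIndex_neg (hH x) (hH' x)]
  exact hx

/-! ## §3 The signature law: exact indices on both sides of a root with non-degenerate kernel form -/

/-- **THE SIGNATURE LAW, right side.**  `F x = F x₀ + (x − x₀) • G x` hermitian, `G` entrywise continuous; kernel families
`n⁻ : β → ℝ^ι` (`G x₀`-negative) and `n⁺ : γ → ℝ^ι` (`G x₀`-positive) with `card β + card γ = corank F x₀` (the kernel form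
is non-degenerate with `card β` negative and `card γ` positive squares).  Then for all `x > x₀` near `x₀`:
`ν(F x) = ν(F x₀) + card β`, `π(F x) = π(F x₀) + card γ`, and `F x` is non-singular. [folklore]
(semisimple case of [GohbergLancasterRodman2005, Thm 12.5.2]) -/
theorem eventually_indices_eq_right {β γ : Type} [Fintype β] [Fintype γ] (F G : ℝ → Matrix ι ι ℝ) (x₀ : ℝ)
    (hG : ∀ i j, Continuous fun x => G x i j) (hFG : ∀ x, F x = F x₀ + (x - x₀) • G x)
    (hH : ∀ x, (F x).IsHermitian) (nm : β → ι → ℝ) (np : γ → ι → ℝ)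
    (hnm0 : ∀ j, F x₀ *ᵥ nm j = 0) (hnp0 : ∀ j, F x₀ *ᵥ np j = 0)
    (hnm : ∀ c : β → ℝ, c ≠ 0 → (∑ j, c j • nm j) ⬝ᵥ (G x₀ *ᵥ ∑ j, c j • nm j) < 0)
    (hnp : ∀ c : γ → ℝ, c ≠ 0 → 0 < (∑ j, c j • np j) ⬝ᵥ (G x₀ *ᵥ ∑ j, c j • np j))
    (hcard : Fintype.card β + Fintype.card γ = Fintype.card ι - (F x₀).rank) :
    ∀ᶠ x in 𝓝[>] x₀,
      Fintype.card {j // (hH x).eigenvalues j < 0} = Fintype.card {j // (hH x₀).eigenvalues j < 0} + Fintype.card β ∧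
      Fintype.card {j // 0 < (hH x).eigenvalues j} = Fintype.card {j // 0 < (hH x₀).eigenvalues j} + Fintype.card γ ∧
      Fintype.card ι - (F x).rank = 0 := by
  have h1 := eventually_negIndex_ge_add_right F G x₀ hG hFG hH nm hnm0 hnm
  have h2 := eventually_posIndex_ge_add_right F G x₀ hG hFG hH np hnp0 hnp
  refine (h1.and h2).mono fun x hx => ?_
  have h0 := negIndex_add_posIndex_add_corank (hH x₀)
  have hx' := negIndex_add_posIndex_add_corank (hH x)
  have hr := Matrix.rank_le_card_width (F x)
  have hr0 := Matrix.rank_le_card_width (F x₀)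
  omega

/-- **THE SIGNATURE LAW, left side.**  Same data; for all `x < x₀` near `x₀`: `ν(F x) = ν(F x₀) + card γ`,
`π(F x) = π(F x₀) + card β`, and `F x` is non-singular. [folklore] -/
theorem eventually_indices_eq_left {β γ : Type} [Fintype β] [Fintype γ] (F G : ℝ → Matrix ι ι ℝ) (x₀ : ℝ)
    (hG : ∀ i j, Continuous fun x => G x i j) (hFG : ∀ x, F x = F x₀ + (x - x₀) • G x)
    (hH : ∀ x, (F x).IsHermitian) (nm : β → ι → ℝ) (np : γ → ι → ℝ)
    (hnm0 : ∀ j, F x₀ *ᵥ nm j = 0) (hnp0 : ∀ j, F x₀ *ᵥ np j = 0)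
    (hnm : ∀ c : β → ℝ, c ≠ 0 → (∑ j, c j • nm j) ⬝ᵥ (G x₀ *ᵥ ∑ j, c j • nm j) < 0)
    (hnp : ∀ c : γ → ℝ, c ≠ 0 → 0 < (∑ j, c j • np j) ⬝ᵥ (G x₀ *ᵥ ∑ j, c j • np j))
    (hcard : Fintype.card β + Fintype.card γ = Fintype.card ι - (F x₀).rank) :
    ∀ᶠ x in 𝓝[<] x₀,
      Fintype.card {j // (hH x).eigenvalues j < 0} = Fintype.card {j // (hH x₀).eigenvalues j < 0} + Fintype.card γ ∧
      Fintype.card {j // 0 < (hH x).eigenvalues j} = Fintype.card {j // 0 < (hH x₀).eigenvalues j} + Fintype.card β ∧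
      Fintype.card ι - (F x).rank = 0 := by
  have h1 := eventually_negIndex_ge_add_left F G x₀ hG hFG hH np hnp0 hnp
  have h2 := eventually_posIndex_ge_add_left F G x₀ hG hFG hH nm hnm0 hnm
  refine (h1.and h2).mono fun x hx => ?_
  have h0 := negIndex_add_posIndex_add_corank (hH x₀)
  have hx' := negIndex_add_posIndex_add_corank (hH x)
  have hr := Matrix.rank_le_card_width (F x)
  have hr0 := Matrix.rank_le_card_width (F x₀)
  omega

/-- **THE JUMP.**  Under the signature-law hypotheses, for all `a < x₀ < b` close enough to `x₀`:
`ν(F b) + card γ = ν(F a) + card β`, i.e. `ν(x₀⁺) − ν(x₀⁻) = card β − card γ` (minus the signature of the kernel form),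
and symmetrically `π(F a) + card γ = π(F b) + card β`. [folklore] -/
theorem negIndex_jump_eq {β γ : Type} [Fintype β] [Fintype γ] (F G : ℝ → Matrix ι ι ℝ) (x₀ : ℝ)
    (hG : ∀ i j, Continuous fun x => G x i j) (hFG : ∀ x, F x = F x₀ + (x - x₀) • G x)
    (hH : ∀ x, (F x).IsHermitian) (nm : β → ι → ℝ) (np : γ → ι → ℝ)
    (hnm0 : ∀ j, F x₀ *ᵥ nm j = 0) (hnp0 : ∀ j, F x₀ *ᵥ np j = 0)
    (hnm : ∀ c : β → ℝ, c ≠ 0 → (∑ j, c j • nm j) ⬝ᵥ (G x₀ *ᵥ ∑ j, c j • nm j) < 0)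
    (hnp : ∀ c : γ → ℝ, c ≠ 0 → 0 < (∑ j, c j • np j) ⬝ᵥ (G x₀ *ᵥ ∑ j, c j • np j))
    (hcard : Fintype.card β + Fintype.card γ = Fintype.card ι - (F x₀).rank) :
    ∃ δ > 0, ∀ a b : ℝ, x₀ - δ < a → a < x₀ → x₀ < b → b < x₀ + δ →
      Fintype.card {j // (hH b).eigenvalues j < 0} + Fintype.card γ
          = Fintype.card {j // (hH a).eigenvalues j < 0} + Fintype.card β ∧
      Fintype.card {j // 0 < (hH a).eigenvalues j} + Fintype.card γ
          = Fintype.card {j // 0 < (hH b).eigenvalues j} + Fintype.card β := by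
  have hR := eventually_indices_eq_right F G x₀ hG hFG hH nm np hnm0 hnp0 hnm hnp hcard
  have hL := eventually_indices_eq_left F G x₀ hG hFG hH nm np hnm0 hnp0 hnm hnp hcard
  rw [eventually_nhdsWithin_iff, Metric.eventually_nhds_iff] at hR hL
  obtain ⟨δ₁, hδ₁, h₁⟩ := hR
  obtain ⟨δ₂, hδ₂, h₂⟩ := hL
  refine ⟨min δ₁ δ₂, lt_min hδ₁ hδ₂, fun a b ha hax hxb hb => ?_⟩
  have hb' := h₁ (y := b) (by
    rw [Real.dist_eq, abs_lt]; constructor <;> linarith [min_le_left δ₁ δ₂]) hxb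
  have ha' := h₂ (y := a) (by
    rw [Real.dist_eq, abs_lt]; constructor <;> linarith [min_le_right δ₁ δ₂]) hax
  omega

end Inertia

end Summit.ValiantsHypothesis.ValiantsHypothesis.Theorems.LacunarySymmetroidMatrixDescartes
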